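import Mathlib
import Summits.ValiantsHypothesis.ValiantsHypothesis.Theorems.NewtonUnitEquationsDissociatedUniformTotalsLawConeSweep
import Summits.ValiantsHypothesis.ValiantsHypothesis.Theorems.NewtonUnitEquationsDissociatedUniformTotalsLawTrigRotation
import Summits.ValiantsHypothesis.ValiantsHypothesis.Theorems.NewtonUnitEquationsDissociatedUniformTotalsLawLargeThirdPointwise
import HarnessLib

/-!
# Crux `NewtonUnitEquations.DissociatedUniform` (stmt-ValiantsHypothesis-5905): fibres of a RIGID PAIR (two sampled circles) —
# strictly convex sampled ellipses, turning rigidly with the fibre index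

Memo `Cruxes/DissociatedUniform/NOTES-t1g8.md` §2/§5(i) (the orientation dichotomy of the pointwise question lives on pairs of sampled
circles `a = trigCurve c₁ A φ`, `b = trigCurve c₂ B ψ`).  This file supplies the geometry of such a pair needed by the pointwise law of
`…TotalsLawRigidPairs`:

* `strictlyConvexCcw_trigCurve` — a sampled circle / regular `q`-gon (`A ≠ 0`, `q ≥ 3`) is in strict counter-clockwise convex position
  (`det = 4A² sin(π/q) sin((k−1)π/q) sin(kπ/q) > 0`);
* `bpt_trigCurve_eq` — every fibre `x ↦ a x + b(s − z − x)` is an AFFINE IMAGE (determinant `A² − B²`) of a regular `q`-gon (a sampled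
  ellipse with semi-axes `|A+B|, |A−B|`), hence `strictlyConvexCcw_bpt_trigCurve` (`B² < A²`) and `sharpTops_bpt_trigCurve`;
* `bpt_trigCurve_shift` — PAIR RIGIDITY: `bpt (u − 2x) (x + w) = (c₁+c₂) + R_{2πx/q}(bpt u w − (c₁+c₂))` (both labels advance by `x`), and
  `trigCurve_add_natCast'` for one circle; `wTop_rot_shift` transports weak tops along such rigid shifts;
* rotation bookkeeping (`rot_rot`, `rot_dotProduct_rot`, `rot_udir`, …) and `ℤ/q`-valued angle bookkeeping (`exists_val_add_eq`, `udir_val_add`).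
Honest label: lemmas about the census families; `CoOrientedClassBound`, `SmoothSharpTotalsLaw`, `TotalsLawThree` remain OPEN; nothing here
bears on VP ≠ VNP.
[folklore: regular polygons are strictly convex; an ellipse is an affine image of a circle]
-/

set_option linter.dupNamespace false -- `ValiantsHypothesis.ValiantsHypothesis` (summit = problem) in every name

open scoped BigOperators

namespace Summit.ValiantsHypothesis.ValiantsHypothesis.Theorems.NewtonUnitEquationsDissociatedUniform

namespace TotalsLaw

open Matrix Real

section TrigFibres

variable {q : ℕ} [NeZero q]

/-! #### Rotations and unit directions -/

/-- The unit direction at angle `t`. -/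
noncomputable def udir (t : ℝ) : Fin 2 → ℝ := ![Real.cos t, Real.sin t]

omit [NeZero q] in
/-- Composition of rotations. [folklore] -/
theorem rot_rot (a b : ℝ) (v : Fin 2 → ℝ) : rot a (rot b v) = rot (a + b) v := by
  ext i; fin_cases i <;> simp [rot, Real.cos_add, Real.sin_add] <;> ring

omit [NeZero q] in
/-- The trivial rotation. [folklore] -/
theorem rot_zero (v : Fin 2 → ℝ) : rot 0 v = v := by
  ext i; fin_cases i <;> simp [rot]

omit [NeZero q] in
/-- Undoing a rotation. [folklore] -/
theorem rot_neg_rot (a : ℝ) (v : Fin 2 → ℝ) : rot (-a) (rot a v) = v := by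
  rw [rot_rot, neg_add_cancel, rot_zero]

omit [NeZero q] in
/-- Rotations are linear: scalars. [folklore] -/
theorem rot_smul (a c : ℝ) (v : Fin 2 → ℝ) : rot a (c • v) = c • rot a v := by
  ext i; fin_cases i <;> simp [rot] <;> ring

omit [NeZero q] in
/-- Rotations are linear: differences. [folklore] -/
theorem rot_sub (a : ℝ) (u v : Fin 2 → ℝ) : rot a (u - v) = rot a u - rot a v := by
  ext i; fin_cases i <;> simp [rot] <;> ring

omit [NeZero q] in
/-- Rotations preserve the inner product. [folklore] -/
theorem rot_dotProduct_rot (a : ℝ) (u v : Fin 2 → ℝ) : rot a u ⬝ᵥ rot a v = u ⬝ᵥ v := by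
  simp only [rot, dotProduct_fin_two, Matrix.cons_val_zero, Matrix.cons_val_one]
  linear_combination (u 0 * v 0 + u 1 * v 1) * Real.sin_sq_add_cos_sq a

omit [NeZero q] in
/-- A rotation of a non-zero vector is non-zero. [folklore] -/
theorem rot_ne_zero (a : ℝ) {v : Fin 2 → ℝ} (hv : v ≠ 0) : rot a v ≠ 0 := by
  intro h
  have := rot_neg_rot a v
  rw [h] at this
  have h0 : rot (-a) (0 : Fin 2 → ℝ) = 0 := by ext i; fin_cases i <;> simp [rot]
  exact hv (this.symm.trans h0)

omit [NeZero q] in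
/-- Rotating a unit direction adds the angle. [folklore] -/
theorem rot_udir (a t : ℝ) : rot a (udir t) = udir (t + a) := by
  ext i; fin_cases i <;> simp [rot, udir, Real.cos_add, Real.sin_add] <;> ring

omit [NeZero q] in
/-- Unit directions are `2π`-periodic. [folklore] -/
theorem udir_add_int_mul (t : ℝ) (m : ℤ) : udir (t + m * (2 * π)) = udir t := by
  ext i; fin_cases i
  · simp [udir, Real.cos_add_int_mul_two_pi]
  · simp [udir, Real.sin_add_int_mul_two_pi]

/-- A sampled circle in terms of unit directions. [folklore] -/
theorem trigCurve_eq_udir (c₀ : Fin 2 → ℝ) (A φ : ℝ) (k : ZMod q) :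
    trigCurve c₀ A φ k = c₀ + A • udir (φ + 2 * π * (k.val : ℝ) / q) := by
  unfold trigCurve udir
  ext i; fin_cases i <;> simp

/-! #### `ℤ/q`-valued angle bookkeeping -/

/-- `val (z + w) = val z + val w (mod q)`, as a real identity with an integer multiple of `q`. [folklore] -/
theorem exists_val_add_eq (z w : ZMod q) : ∃ m : ℤ, ((z + w).val : ℝ) = z.val + w.val + m * q := by
  obtain ⟨m, hm⟩ : (q : ℤ) ∣ ((z + w).val : ℤ) - (z.val + w.val) := by
    rw [← ZMod.intCast_zmod_eq_zero_iff_dvd]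
    push_cast
    rw [ZMod.natCast_zmod_val, ZMod.natCast_zmod_val, ZMod.natCast_zmod_val]; ring
  refine ⟨m, ?_⟩
  have h := congrArg (fun t : ℤ => (t : ℝ)) hm
  push_cast at h
  linarith

/-- `val (z - w) = val z - val w (mod q)`, as a real identity with an integer multiple of `q`. [folklore] -/
theorem exists_val_sub_eq (z w : ZMod q) : ∃ m : ℤ, ((z - w).val : ℝ) = z.val - w.val + m * q := by
  obtain ⟨m, hm⟩ : (q : ℤ) ∣ ((z - w).val : ℤ) - (z.val - w.val) := by
    rw [← ZMod.intCast_zmod_eq_zero_iff_dvd]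
    push_cast
    rw [ZMod.natCast_zmod_val, ZMod.natCast_zmod_val, ZMod.natCast_zmod_val]; ring
  refine ⟨m, ?_⟩
  have h := congrArg (fun t : ℤ => (t : ℝ)) hm
  push_cast at h
  linarith

/-- Angle bookkeeping: the sampling angle of `z + w` is the sum of the sampling angles (as unit directions). [folklore] -/
theorem udir_val_add (φ : ℝ) (z w : ZMod q) :
    udir (φ + 2 * π * ((z + w).val : ℝ) / q) = udir (φ + 2 * π * (z.val : ℝ) / q + 2 * π * (w.val : ℝ) / q) := by
  have hq : (q : ℝ) ≠ 0 := by exact_mod_cast NeZero.ne q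
  obtain ⟨m, hm⟩ := exists_val_add_eq z w
  rw [hm, show φ + 2 * π * ((z.val : ℝ) + w.val + m * q) / q =
    (φ + 2 * π * (z.val : ℝ) / q + 2 * π * (w.val : ℝ) / q) + m * (2 * π) by field_simp; ring, udir_add_int_mul]

/-- Angle bookkeeping: the sampling angle of `z - w` is the difference of the sampling angles (as unit directions). [folklore] -/
theorem udir_val_sub (φ : ℝ) (z w : ZMod q) :
    udir (φ + 2 * π * ((z - w).val : ℝ) / q) = udir (φ + 2 * π * (z.val : ℝ) / q - 2 * π * (w.val : ℝ) / q) := by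
  have hq : (q : ℝ) ≠ 0 := by exact_mod_cast NeZero.ne q
  obtain ⟨m, hm⟩ := exists_val_sub_eq z w
  rw [hm, show φ + 2 * π * ((z.val : ℝ) - w.val + m * q) / q =
    (φ + 2 * π * (z.val : ℝ) / q - 2 * π * (w.val : ℝ) / q) + m * (2 * π) by field_simp; ring, udir_add_int_mul]

/-- **Advancing the label by `n` turns a sampled circle by `2πn/q` about its centre.** [folklore] -/
theorem trigCurve_add_natCast' (c₀ : Fin 2 → ℝ) (A φ : ℝ) (k : ZMod q) (n : ℕ) :
    trigCurve c₀ A φ (k + (n : ZMod q)) = c₀ + rot (2 * π * n / q) (trigCurve c₀ A φ k - c₀) := by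
  induction n with
  | zero => simp [rot_zero]
  | succ n ih =>
    rw [Nat.cast_succ, ← add_assoc, trigCurve_add_one, ih, add_sub_cancel_left, rot_rot]
    congr 2; push_cast; ring

/-- The same with a `ℤ/q` label shift `x` (angle `2π·val x/q`). [folklore] -/
theorem trigCurve_add_eq_rot (c₀ : Fin 2 → ℝ) (A φ : ℝ) (k x : ZMod q) :
    trigCurve c₀ A φ (k + x) = c₀ + rot (2 * π * (x.val : ℝ) / q) (trigCurve c₀ A φ k - c₀) := by
  conv_lhs => rw [← ZMod.natCast_zmod_val x]
  exact trigCurve_add_natCast' c₀ A φ k x.val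

/-! #### Regular polygons are strictly convex -/

omit [NeZero q] in
/-- The oriented area of a triangle inscribed in the unit circle. [folklore] -/
theorem cross2_udir_sub (a b c : ℝ) :
    cross2 (udir a - udir b) (udir c - udir b) = Real.sin (c - a) + Real.sin (a - b) + Real.sin (b - c) := by
  simp only [cross2, udir, Pi.sub_apply, Matrix.cons_val_zero, Matrix.cons_val_one, Real.sin_sub]
  ring

omit [NeZero q] in
/-- The triple-sine identity `sin 2β + sin 2γ − sin(2β + 2γ) = 4 sin β sin γ sin(β + γ)`. [folklore] -/
theorem sin_add_sin_sub_sin (β γ : ℝ) :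
    Real.sin (2 * β) + Real.sin (2 * γ) - Real.sin (2 * β + 2 * γ) = 4 * Real.sin β * Real.sin γ * Real.sin (β + γ) := by
  rw [Real.sin_add (2 * β), Real.sin_add β γ, Real.sin_two_mul, Real.sin_two_mul, Real.cos_two_mul, Real.cos_two_mul]
  linear_combination (-(4 : ℝ) * Real.sin β * Real.cos β) * Real.sin_sq_add_cos_sq γ +
    (-(4 : ℝ) * Real.sin γ * Real.cos γ) * Real.sin_sq_add_cos_sq β

omit [NeZero q] in
/-- Positivity of the inscribed-triangle area for the vertices `0 < 1 < k` of a regular `q`-gon (`2 ≤ k ≤ q − 1`). [folklore] -/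
theorem sin_chords_pos (hq : 3 ≤ q) {k : ℕ} (hk2 : 2 ≤ k) (hkq : k < q) :
    0 < Real.sin ((k - 1 : ℝ) * (2 * π / q)) + Real.sin (2 * π / q) - Real.sin (k * (2 * π / q)) := by
  have hqpos : (0 : ℝ) < q := by exact_mod_cast (show 0 < q by omega)
  have e1 : Real.sin ((k - 1 : ℝ) * (2 * π / q)) = Real.sin (2 * ((k - 1) * π / q)) := by congr 1; ring
  have e2 : Real.sin (2 * π / q) = Real.sin (2 * (π / q)) := by congr 1; ring
  have e3 : Real.sin (k * (2 * π / q)) = Real.sin (2 * (π / q) + 2 * ((k - 1) * π / q)) := by congr 1; ring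
  rw [e1, e2, e3]
  have hid := sin_add_sin_sub_sin (π / q) ((k - 1) * π / q)
  have hk1 : (1 : ℝ) ≤ (k : ℝ) - 1 := by
    have : (2 : ℝ) ≤ k := by exact_mod_cast hk2
    linarith
  have hkq' : (k : ℝ) ≤ q - 1 := by
    have : (k : ℝ) + 1 ≤ q := by exact_mod_cast hkq
    linarith
  have h1 : 0 < Real.sin (π / q) :=
    Real.sin_pos_of_pos_of_lt_pi (div_pos Real.pi_pos hqpos)
      (by rw [div_lt_iff₀ hqpos]; nlinarith [Real.pi_pos, show (3 : ℝ) ≤ q by exact_mod_cast hq])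
  have h2 : 0 < Real.sin ((k - 1) * π / q) :=
    Real.sin_pos_of_pos_of_lt_pi (by positivity)
      (by rw [div_lt_iff₀ hqpos]; nlinarith [Real.pi_pos])
  have h3 : 0 < Real.sin (π / q + (k - 1) * π / q) := by
    have e4 : π / q + (k - 1) * π / q = k * π / q := by ring
    rw [e4]
    exact Real.sin_pos_of_pos_of_lt_pi (by positivity) (by rw [div_lt_iff₀ hqpos]; nlinarith [Real.pi_pos])
  have h4 : 0 < 4 * Real.sin (π / q) * Real.sin ((k - 1) * π / q) * Real.sin (π / q + (k - 1) * π / q) := by positivity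
  linarith

/-- **A sampled circle / regular `q`-gon is in strict counter-clockwise convex position** (`A ≠ 0`, `q ≥ 3`; also for `A < 0`,
which is the same polygon with phase `φ + π`). [folklore] -/
theorem strictlyConvexCcw_trigCurve (hq : 3 ≤ q) (c₀ : Fin 2 → ℝ) {A : ℝ} (hA : A ≠ 0) (φ : ℝ) :
    StrictlyConvexCcw (trigCurve (q := q) c₀ A φ) := by
  intro z x hx0 hx1
  have hqpos : (0 : ℝ) < q := by exact_mod_cast (show 0 < q by omega)
  have hqne : (q : ℝ) ≠ 0 := hqpos.ne'
  -- the position `k` of `x` after `z`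
  set k : ℕ := (x - z).val with hk
  have hkq : k < q := ZMod.val_lt _
  have hxz : x = z + (k : ZMod q) := by rw [hk, ZMod.natCast_zmod_val, add_sub_cancel]
  have hk0 : k ≠ 0 := fun h => hx0 (by rw [hxz, h, Nat.cast_zero, add_zero])
  have hk1 : k ≠ 1 := fun h => hx1 (by rw [hxz, h, Nat.cast_one])
  have hk2 : 2 ≤ k := by omega
  -- angles
  set α : ℝ := 2 * π / q with hα
  set t : ℝ := φ + 2 * π * (z.val : ℝ) / q with ht
  have h1v : ((1 : ZMod q).val : ℝ) = 1 := by
    rw [ZMod.val_one'' (by omega)]; simp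
  have hkv : (((k : ℕ) : ZMod q).val : ℝ) = k := by rw [ZMod.val_natCast_of_lt hkq]
  have ez1 : trigCurve c₀ A φ (z + 1) - trigCurve c₀ A φ z = A • (udir (t + α) - udir t) := by
    rw [trigCurve_eq_udir, trigCurve_eq_udir, udir_val_add, h1v, add_sub_add_left_eq_sub, ← smul_sub]
    congr 3; rw [hα]; ring
  have ezx : trigCurve c₀ A φ x - trigCurve c₀ A φ z = A • (udir (t + k * α) - udir t) := by
    rw [hxz, trigCurve_eq_udir, trigCurve_eq_udir, udir_val_add, hkv, add_sub_add_left_eq_sub, ← smul_sub]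
    congr 3; rw [hα]; ring
  have hcross : cross2 (trigCurve c₀ A φ (z + 1) - trigCurve c₀ A φ z) (trigCurve c₀ A φ x - trigCurve c₀ A φ z) =
      A ^ 2 * (Real.sin ((k - 1 : ℝ) * α) + Real.sin α - Real.sin (k * α)) := by
    rw [ez1, ezx]
    simp only [cross2, Pi.smul_apply, Pi.sub_apply, smul_eq_mul]
    have := cross2_udir_sub (t + α) t (t + k * α)
    simp only [cross2, Pi.sub_apply] at this
    rw [show (t + k * α - (t + α)) = (k - 1 : ℝ) * α by ring, show t + α - t = α by ring,
      show t - (t + k * α) = -(k * α) by ring, Real.sin_neg] at this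
    linear_combination A ^ 2 * this
  rw [hcross]
  exact mul_pos (by positivity) (sin_chords_pos hq hk2 hkq)

/-! #### Affine images -/

/-- A plane linear map given by its four entries. -/
def lin2 (m₀₀ m₀₁ m₁₀ m₁₁ : ℝ) (v : Fin 2 → ℝ) : Fin 2 → ℝ := ![m₀₀ * v 0 + m₀₁ * v 1, m₁₀ * v 0 + m₁₁ * v 1]

omit [NeZero q] in
/-- `lin2` is additive (differences). [folklore] -/
theorem lin2_sub (m₀₀ m₀₁ m₁₀ m₁₁ : ℝ) (u v : Fin 2 → ℝ) :
    lin2 m₀₀ m₀₁ m₁₀ m₁₁ u - lin2 m₀₀ m₀₁ m₁₀ m₁₁ v = lin2 m₀₀ m₀₁ m₁₀ m₁₁ (u - v) := by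
  ext i; fin_cases i <;> simp [lin2] <;> ring

omit [NeZero q] in
/-- `det(L u, L v) = det L · det(u, v)`. [folklore] -/
theorem cross2_lin2 (m₀₀ m₀₁ m₁₀ m₁₁ : ℝ) (u v : Fin 2 → ℝ) :
    cross2 (lin2 m₀₀ m₀₁ m₁₀ m₁₁ u) (lin2 m₀₀ m₀₁ m₁₀ m₁₁ v) = (m₀₀ * m₁₁ - m₀₁ * m₁₀) * cross2 u v := by
  simp [cross2, lin2]; ring

omit [NeZero q] in
/-- **Affine images with positive determinant preserve strict ccw convex position.** [folklore] -/
theorem StrictlyConvexCcw.affine {e : ZMod q → (Fin 2 → ℝ)} (he : StrictlyConvexCcw e) (o : Fin 2 → ℝ)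
    {m₀₀ m₀₁ m₁₀ m₁₁ : ℝ} (hdet : 0 < m₀₀ * m₁₁ - m₀₁ * m₁₀) :
    StrictlyConvexCcw fun x => o + lin2 m₀₀ m₀₁ m₁₀ m₁₁ (e x) := by
  intro z x hx0 hx1
  simp only [add_sub_add_left_eq_sub, lin2_sub, cross2_lin2]
  exact mul_pos hdet (he z x hx0 hx1)

/-! #### The fibres of a pair of sampled circles -/

/-- **Sampled-ellipse form of the fibres.**  For `a = trigCurve c₁ A φ`, `b = trigCurve c₂ B ψ` and `r = s − z`, the fibre point with
first label `x` is `(c₁ + c₂) + L(udir(δ + 2πx/q))` with `L = R_γ ∘ diag(A+B, A−B)`, `γ = (φ+ψ+2πr/q)/2`, `δ = (φ−ψ−2πr/q)/2`. [folklore] -/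
theorem bpt_trigCurve_eq (c₁ c₂ : Fin 2 → ℝ) (A B φ ψ : ℝ) (s z x : ZMod q) :
    bpt (trigCurve c₁ A φ) (trigCurve c₂ B ψ) s z x =
      (c₁ + c₂) + lin2 ((A + B) * Real.cos ((φ + ψ + 2 * π * ((s - z).val : ℝ) / q) / 2))
        (-((A - B) * Real.sin ((φ + ψ + 2 * π * ((s - z).val : ℝ) / q) / 2)))
        ((A + B) * Real.sin ((φ + ψ + 2 * π * ((s - z).val : ℝ) / q) / 2))
        ((A - B) * Real.cos ((φ + ψ + 2 * π * ((s - z).val : ℝ) / q) / 2))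
        (udir ((φ - ψ - 2 * π * ((s - z).val : ℝ) / q) / 2 + 2 * π * (x.val : ℝ) / q)) := by
  set γ : ℝ := (φ + ψ + 2 * π * ((s - z).val : ℝ) / q) / 2 with hγ
  set δ : ℝ := (φ - ψ - 2 * π * ((s - z).val : ℝ) / q) / 2 with hδ
  set τ : ℝ := δ + 2 * π * (x.val : ℝ) / q with hτ
  have e1 : φ + 2 * π * (x.val : ℝ) / q = γ + τ := by rw [hτ, hγ, hδ]; ring
  have e2 : ψ + 2 * π * ((s - z).val : ℝ) / q - 2 * π * (x.val : ℝ) / q = γ - τ := by rw [hτ, hγ, hδ]; ring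
  rw [bpt, trigCurve_eq_udir, trigCurve_eq_udir, udir_val_sub, e1, e2]
  ext i; fin_cases i <;>
    simp [udir, lin2, Matrix.vecHead, Matrix.vecTail, Real.cos_add, Real.sin_add, Real.cos_sub, Real.sin_sub] <;> ring

/-- **The fibres of a pair of sampled circles with `B² < A²` are strictly convex ccw `q`-gons** (in the first label; `q ≥ 3`). [folklore] -/
theorem strictlyConvexCcw_bpt_trigCurve (hq : 3 ≤ q) (c₁ c₂ : Fin 2 → ℝ) {A B : ℝ} (hAB : B ^ 2 < A ^ 2) (φ ψ : ℝ)
    (s z : ZMod q) : StrictlyConvexCcw (bpt (trigCurve c₁ A φ) (trigCurve c₂ B ψ) s z) := by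
  set γ : ℝ := (φ + ψ + 2 * π * ((s - z).val : ℝ) / q) / 2 with hγ
  set δ : ℝ := (φ - ψ - 2 * π * ((s - z).val : ℝ) / q) / 2 with hδ
  have hreg : StrictlyConvexCcw (trigCurve (q := q) 0 1 δ) := strictlyConvexCcw_trigCurve hq 0 one_ne_zero δ
  have hdet : 0 < (A + B) * Real.cos γ * ((A - B) * Real.cos γ) - -((A - B) * Real.sin γ) * ((A + B) * Real.sin γ) := by
    have : (A + B) * Real.cos γ * ((A - B) * Real.cos γ) - -((A - B) * Real.sin γ) * ((A + B) * Real.sin γ) = A ^ 2 - B ^ 2 := by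
      linear_combination (A ^ 2 - B ^ 2) * Real.cos_sq_add_sin_sq γ
    rw [this]; linarith
  have h := hreg.affine (c₁ + c₂) hdet
  have hfun : (fun x => (c₁ + c₂) + lin2 ((A + B) * Real.cos γ) (-((A - B) * Real.sin γ)) ((A + B) * Real.sin γ)
      ((A - B) * Real.cos γ) (trigCurve (q := q) 0 1 δ x)) = bpt (trigCurve c₁ A φ) (trigCurve c₂ B ψ) s z := by
    funext x
    rw [bpt_trigCurve_eq, trigCurve_eq_udir, zero_add, one_smul]
  rwa [hfun] at h

/-- Hence the fibres have SHARP TOPS (at most two weak tops per non-zero weight, label-adjacent). [folklore] -/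
theorem sharpTops_bpt_trigCurve (hq : 3 ≤ q) (c₁ c₂ : Fin 2 → ℝ) {A B : ℝ} (hAB : B ^ 2 < A ^ 2) (φ ψ : ℝ)
    (s z : ZMod q) : SharpTops (bpt (trigCurve c₁ A φ) (trigCurve c₂ B ψ) s z) :=
  sharpTops_of_strictlyConvexCcw (strictlyConvexCcw_bpt_trigCurve hq c₁ c₂ hAB φ ψ s z) hq

/-! #### Pair rigidity -/

/-- **PAIR RIGIDITY.**  Advancing both labels by `x` (so the blob index drops by `2x`) turns the fibre point by `2π·val x/q` about the sum
of the centres: `bpt (u − 2x) (x + w) = (c₁ + c₂) + R (bpt u w − (c₁ + c₂))`. [folklore] -/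
theorem bpt_trigCurve_shift (c₁ c₂ : Fin 2 → ℝ) (A B φ ψ : ℝ) (s u x w : ZMod q) :
    bpt (trigCurve c₁ A φ) (trigCurve c₂ B ψ) s (u - 2 * x) (x + w) =
      (c₁ + c₂) + rot (2 * π * (x.val : ℝ) / q) (bpt (trigCurve c₁ A φ) (trigCurve c₂ B ψ) s u w - (c₁ + c₂)) := by
  rw [bpt, bpt, add_comm x w, show s - (u - 2 * x) - (w + x) = (s - u - w) + x by ring, trigCurve_add_eq_rot,
    trigCurve_add_eq_rot, show trigCurve c₁ A φ w + trigCurve c₂ B ψ (s - u - w) - (c₁ + c₂) =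
      (trigCurve c₁ A φ w - c₁) + (trigCurve c₂ B ψ (s - u - w) - c₂) by abel, rot_add]
  abel

omit [NeZero q] in
/-- **Transport of weak tops along a rigid shift**: if `P' (x + w) = o + R_γ (P w − o)` for all `w`, then `x + w` is a weak top of `P'`
at `R_γ θ` iff `w` is a weak top of `P` at `θ`. [folklore] -/
theorem wTop_rot_shift {P P' : ZMod q → (Fin 2 → ℝ)} {o : Fin 2 → ℝ} {γ : ℝ} {x : ZMod q}
    (h : ∀ w, P' (x + w) = o + rot γ (P w - o)) (θ : Fin 2 → ℝ) (w : ZMod q) :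
    WTop P' (rot γ θ) (x + w) ↔ WTop P θ w := by
  have key : ∀ w', rot γ θ ⬝ᵥ P' (x + w') = rot γ θ ⬝ᵥ o + (θ ⬝ᵥ P w' - θ ⬝ᵥ o) := by
    intro w'
    rw [h w', dotProduct_add, rot_dotProduct_rot γ θ (P w' - o), dotProduct_sub]
  constructor
  · intro hw w'
    have := hw (x + w')
    rw [key, key] at this
    linarith
  · intro hw y
    have := hw (y - x)
    rw [show y = x + (y - x) by ring, key, key]
    linarith

end TrigFibres

end TotalsLaw

end Summit.ValiantsHypothesis.ValiantsHypothesis.Theorems.NewtonUnitEquationsDissociatedUniform
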